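import Literature.AlgebraicTopology.SingularHomology.CapProduct
import Literature.AlgebraicTopology.SingularHomology.ExcisionTheorem
import Literature.AlgebraicTopology.SingularHomology.RelativeHomology
import HarnessLib

/-!
# Locality of Kronecker pairings with classes supported on a subset

A. Hatcher, *Algebraic Topology* (2002), §2.1 (long exact sequence of a pair, Thm. 2.13 ff.;
naturality), Thm. 2.20 (excision), §3.1 (Kronecker pairing is natural). Let `ξ ∈ Hᵏ(T; R)`
vanish on the open complement of `Z ⊆ T` (`ξ|_{T ∖ Z} = 0`). Then for `x ∈ Hₖ(T; M)` the value
`⟨ξ, x⟩` only depends on the image of `x` in `Hₖ(T, T ∖ Z)` (exactness of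
`Hₖ(T ∖ Z) → Hₖ(T) → Hₖ(T, T ∖ Z)`), and for a map `F : S → T` the image of `F₊ a` in
`Hₖ(T, T ∖ Z)` only depends on `F` near `F⁻¹(Z)` (excision of the complement of an open
neighbourhood). Consequently:

* `kroneckerPairing_eq_zero_of_ofAbsolute_eq_zero` — `⟨ξ, x⟩ = 0` if `x ↦ 0 ∈ Hₖ(T, T ∖ Z)`;
* `kroneckerPairing_map_eq_of_eqOn` — **if `F, F' : S → T` agree on an open set `O` containing
  a closed set `C` with `F⁻¹(Z) ∪ F'⁻¹(Z) ⊆ C`, then `⟨ξ, F₊ a⟩ = ⟨ξ, F'₊ a⟩` for every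
  `a ∈ Hₖ(S; M)`**.

For the `E₈` plumbing (Kosinski, *Differential Manifolds* (1993), VI.12) this makes the Kronecker
hypotheses of `HomotopySphere.exists_intersectionForm_equivalent_e8Form_of_kroneckerData`
(`HomotopySpheresE8KroneckerTable.lean`) local: the collapsed Thom class `uᵥ` vanishes off the
core diagonal, so `⟨u_w, (π_w ∘ σᵥ)₊[Sᵏ]⟩` may be computed from any map agreeing with
`π_w ∘ σᵥ` near the plumbing patch (e.g. the collapse of a fibre slice,
`SphereProd.kroneckerPairing_thomClass_map_sliceAt`). Everything is proved; no definitions.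

## References

* A. Hatcher, *Algebraic Topology*, CUP 2002, §2.1 (Thm. 2.13 ff.), Thm. 2.20, §3.1.
  [HatcherAT2002]
-/

noncomputable section

open CategoryTheory Set

universe u v

namespace Literature.AlgebraicTopology.SingularHomology

variable (R : Type v) [CommRing R] (M : Type v) [AddCommGroup M] [Module R M]
variable {S T : Type u} [TopologicalSpace S] [TopologicalSpace T]

/-- **`⟨ξ, x⟩` vanishes when `ξ` vanishes off `Z` and `x` dies in `Hₖ(T, T ∖ Z)`**: by exactness of
`Hₖ(T ∖ Z) → Hₖ(T) → Hₖ(T, T ∖ Z)` the class `x` comes from `T ∖ Z`, where `ξ` restricts to `0`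
(naturality of the Kronecker pairing). [cite: HatcherAT2002, §2.1 Thm. 2.13 ff., §3.1] -/
theorem kroneckerPairing_eq_zero_of_ofAbsolute_eq_zero {k : ℕ} (Z : Set T)
    (ξ : singularCohomology R R T k)
    (hξ : singularCohomology.map R R (subsetIncl Zᶜ) k ξ = 0) (x : singularHomology R M T k)
    (hx : relativeSingularHomology.ofAbsolute R M T Zᶜ k x = 0) :
    kroneckerPairing R M T k ξ x = 0 := by
  have hex := relativeSingularHomology.exact_map_ofAbsolute R M (X := T) Zᶜ k
  rw [ShortComplex.moduleCat_exact_iff] at hex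
  obtain ⟨y, hy⟩ := hex x hx
  change singularHomology.map R M (subsetIncl Zᶜ) k y = x at hy
  rw [← hy, ← kroneckerPairing_map, hξ]
  simp

/-- The image in `Hₖ(T, T ∖ Z)` of `F₊ a` is computed through the pair map
`(S, S ∖ C) → (T, T ∖ Z)` when `F⁻¹(Z) ⊆ C`. [cite: HatcherAT2002, §2.1 (naturality)] -/
theorem ofAbsolute_map_eq {k : ℕ} (Z : Set T) (F : C(S, T)) {C : Set S} (hF : F ⁻¹' Z ⊆ C)
    (a : singularHomology R M S k) :
    relativeSingularHomology.ofAbsolute R M T Zᶜ k (singularHomology.map R M F k a) =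
      relativeSingularHomology.map R M F
        (show MapsTo F Cᶜ Zᶜ from fun _ hs hz => hs (hF hz)) k
        (relativeSingularHomology.ofAbsolute R M S Cᶜ k a) := by
  have h := relativeSingularHomology.ofAbsolute_comp_map R M (X := S) (Y := T) (A := Cᶜ) (B := Zᶜ)
    F (fun _ hs hz => hs (hF hz)) k
  have := congrArg (fun φ => φ a) h
  simp only [ModuleCat.comp_apply] at this
  exact this.symm

/-- **Excision form of locality**: if `F, F' : S → T` agree on an open `O ⊇ C`, `C` closed, then
the pair maps `(S, S ∖ C) → (T, T ∖ Z)` they induce (`F⁻¹(Z), F'⁻¹(Z) ⊆ C`) agree on relative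
homology — every class of `Hₖ(S, S ∖ C)` comes from `Hₖ(O, O ∖ C)` (Hatcher, Thm. 2.20, for the
cover `{O, S ∖ C}`), on which the two maps coincide. [cite: HatcherAT2002, Thm. 2.20] -/
theorem relativeMap_eq_of_eqOn {k : ℕ} (Z : Set T) (F F' : C(S, T)) {O C : Set S}
    (hO : IsOpen O) (hC : IsClosed C) (hCO : C ⊆ O) (hF : F ⁻¹' Z ⊆ C) (hF' : F' ⁻¹' Z ⊆ C)
    (hFF' : EqOn F F' O) (b : relativeSingularHomology R M S Cᶜ k) :
    relativeSingularHomology.map R M F (show MapsTo F Cᶜ Zᶜ from fun _ hs hz => hs (hF hz)) k b =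
      relativeSingularHomology.map R M F'
        (show MapsTo F' Cᶜ Zᶜ from fun _ hs hz => hs (hF' hz)) k b := by
  -- excision: `H_k(O, O ∖ C) → H_k(S, S ∖ C)` is onto
  have hcov : interior Cᶜ ∪ interior O = (univ : Set S) := by
    rw [hC.isOpen_compl.interior_eq, hO.interior_eq]
    exact eq_univ_of_forall fun s => by
      by_cases hs : s ∈ C
      · exact Or.inr (hCO hs)
      · exact Or.inl hs
  haveI := relativeSingularHomology.isIso_map_of_interior_union_interior_holds R M S Cᶜ O hcov k
  obtain ⟨b', rfl⟩ := (ConcreteCategory.bijective_of_isIso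
    (relativeSingularHomology.map R M (X := ↥O) (subsetIncl O)
      (Set.mapsTo_preimage Subtype.val Cᶜ : MapsTo _ (Subtype.val ⁻¹' Cᶜ) Cᶜ) k)).2 b
  -- on `O` the two maps agree as continuous maps
  have hcomp : F.comp (subsetIncl O) = F'.comp (subsetIncl O) := by
    ext x; exact hFF' x.2
  have hm : MapsTo (F.comp (subsetIncl O)) (Subtype.val ⁻¹' Cᶜ : Set ↥O) Zᶜ :=
    fun _ hx hz => hx (hF hz)
  have hm' : MapsTo (F'.comp (subsetIncl O)) (Subtype.val ⁻¹' Cᶜ : Set ↥O) Zᶜ :=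
    fun _ hx hz => hx (hF' hz)
  have e1 := relativeSingularHomology.map_comp R M (subsetIncl O) F
    (Set.mapsTo_preimage Subtype.val Cᶜ : MapsTo _ (Subtype.val ⁻¹' Cᶜ) Cᶜ)
    (show MapsTo F Cᶜ Zᶜ from fun _ hs hz => hs (hF hz)) k
  have e2 := relativeSingularHomology.map_comp R M (subsetIncl O) F'
    (Set.mapsTo_preimage Subtype.val Cᶜ : MapsTo _ (Subtype.val ⁻¹' Cᶜ) Cᶜ)
    (show MapsTo F' Cᶜ Zᶜ from fun _ hs hz => hs (hF' hz)) k
  have key : relativeSingularHomology.map R M (F.comp (subsetIncl O)) hm k =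
      relativeSingularHomology.map R M (F'.comp (subsetIncl O)) hm' k := by
    congr 1
  rw [← ModuleCat.comp_apply, ← e1, ← ModuleCat.comp_apply, ← e2]
  exact congrArg (fun φ => (ModuleCat.Hom.hom φ) b') key

/-- **Locality of Kronecker pairings with supported classes.** Let `ξ ∈ Hᵏ(T; R)` vanish on
`T ∖ Z`, and let `F, F' : S → T` agree on an open set `O` containing a closed set `C` with
`F⁻¹(Z) ⊆ C` and `F'⁻¹(Z) ⊆ C`. Then `⟨ξ, F₊ a⟩ = ⟨ξ, F'₊ a⟩` for all `a ∈ Hₖ(S; M)`.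
[cite: HatcherAT2002, §2.1 Thm. 2.13 ff., Thm. 2.20, §3.1] -/
theorem kroneckerPairing_map_eq_of_eqOn {k : ℕ} (Z : Set T) (ξ : singularCohomology R R T k)
    (hξ : singularCohomology.map R R (subsetIncl Zᶜ) k ξ = 0) (F F' : C(S, T)) {O C : Set S}
    (hO : IsOpen O) (hC : IsClosed C) (hCO : C ⊆ O) (hF : F ⁻¹' Z ⊆ C) (hF' : F' ⁻¹' Z ⊆ C)
    (hFF' : EqOn F F' O) (a : singularHomology R M S k) :
    kroneckerPairing R M T k ξ (singularHomology.map R M F k a) =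
      kroneckerPairing R M T k ξ (singularHomology.map R M F' k a) := by
  rw [← sub_eq_zero, ← map_sub]
  refine kroneckerPairing_eq_zero_of_ofAbsolute_eq_zero R M Z ξ hξ _ ?_
  rw [map_sub, ofAbsolute_map_eq R M Z F hF, ofAbsolute_map_eq R M Z F' hF',
    relativeMap_eq_of_eqOn R M Z F F' hO hC hCO hF hF' hFF', sub_self]

end Literature.AlgebraicTopology.SingularHomology
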